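import Mathlib
import Summits.FinalStateConjecture.FinalStateConjecture.Theses.DissipativeFinalMotions

/-!
# Route DissipativeFinalMotions — `DispersalFromBudget` (support item, pure real analysis)

The "dissipative Marchal–Saari" skeleton the typed Statement needs: finitely many curves
`ξ i : ℝ → EuclideanSpace ℝ (Fin 3)` that are `V`-Lipschitz on `[T, ∞)`, and a budget `E : ℝ → ℝ`
antitone and bounded below on `[T, ∞)` which drops by a fixed `ε(D) > 0` within a lag `L(D)`
whenever two distinct curves stay `D`-close throughout a unit time interval, force every pair of
distinct curves to disperse: `‖ξ i t - ξ j t‖ → ∞`.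

Proof (no sequences needed). Suppose `‖ξ i · - ξ j ·‖` does not tend to `∞`; then some bound `D`
is undershot at arbitrarily late times. Put `D' := |D| + 2|V| + 1 > 0` and take the `ε, L` of the
coercivity hypothesis for `D'`. Let `m := inf_{t ≥ T} E t` and choose `t₁ ≥ T` with
`E t₁ < m + ε`. Pick `a ≥ max t₁ T` with `‖ξ i a - ξ j a‖ < D`; by the Lipschitz bound the pair is
`D'`-close on `[a, a + 1]`, so `E (a + L) ≤ E a - ε ≤ E t₁ - ε < m ≤ E (a + L)`, a contradiction.
-/

namespace Summit.FinalStateConjecture.FinalStateConjecture.Theorems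

open Filter Set

/-- **Dispersal from a radiative budget** (item stmt-FinalStateConjecture-10156 of route
`DissipativeFinalMotions`). If the curves `ξ i` are `V`-Lipschitz on `[T, ∞)` and `E` is antitone
and bounded below on `[T, ∞)` with the coercivity "two distinct curves `D'`-close throughout
`[t, t + 1]` (`t ≥ T`) forces `E (t + L) ≤ E t - ε`" for every `D' > 0` (with `ε > 0`, `L ≥ 0`
depending on `D'`), then `‖ξ i t - ξ j t‖ → ∞` as `t → ∞` for all `i ≠ j`. -/
theorem DispersalFromBudget_proof :
    Summit.FinalStateConjecture.FinalStateConjecture.Theses.DissipativeFinalMotions.DispersalFromBudget := by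
  unfold Summit.FinalStateConjecture.FinalStateConjecture.Theses.DissipativeFinalMotions.DispersalFromBudget
  intro N T V ξ E hLip hanti hbdd hcoer i j hij
  by_contra hnot
  rw [Filter.tendsto_atTop_atTop] at hnot
  push Not at hnot
  obtain ⟨D, hD⟩ := hnot
  obtain ⟨ε, L, hε, hL, hc⟩ := hcoer (|D| + 2 * |V| + 1) (by positivity)
  have hne : (E '' Ici T).Nonempty := ⟨E T, T, le_refl T, rfl⟩
  have hlt : sInf (E '' Ici T) < sInf (E '' Ici T) + ε := by linarith
  obtain ⟨y, ⟨t₁, ht₁, rfl⟩, hy⟩ := exists_lt_of_csInf_lt hne hlt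
  obtain ⟨a, ha, hfa⟩ := hD (max t₁ T)
  have hat₁ : t₁ ≤ a := le_trans (le_max_left _ _) ha
  have haT : T ≤ a := le_trans (le_max_right _ _) ha
  have hclose : ∀ s, a ≤ s → s ≤ a + 1 → ‖ξ i s - ξ j s‖ ≤ |D| + 2 * |V| + 1 := by
    intro s has hsa
    have h1 : ‖ξ i s - ξ i a‖ ≤ V * (s - a) := hLip i a s haT has
    have h2 : ‖ξ j s - ξ j a‖ ≤ V * (s - a) := hLip j a s haT has
    have h3 : V * (s - a) ≤ |V| := by
      calc V * (s - a) ≤ |V| * (s - a) :=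
            mul_le_mul_of_nonneg_right (le_abs_self V) (by linarith)
        _ ≤ |V| * 1 := mul_le_mul_of_nonneg_left (by linarith) (abs_nonneg V)
        _ = |V| := mul_one _
    have h4 : ‖ξ i a - ξ j a‖ ≤ |D| := le_trans hfa.le (le_abs_self D)
    have key : dist (ξ i s) (ξ j s)
        ≤ dist (ξ i s) (ξ i a) + dist (ξ i a) (ξ j a) + dist (ξ j a) (ξ j s) :=
      dist_triangle4 _ _ _ _
    simp only [dist_eq_norm] at key
    have h5 : ‖ξ j a - ξ j s‖ = ‖ξ j s - ξ j a‖ := norm_sub_rev _ _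
    linarith
  have hdrop : E (a + L) ≤ E a - ε := hc a haT i j hij hclose
  have hmono : E a ≤ E t₁ := hanti (mem_Ici.mpr ht₁) (mem_Ici.mpr haT) hat₁
  have hmem : E (a + L) ∈ E '' Ici T := ⟨a + L, mem_Ici.mpr (by linarith), rfl⟩
  have hinf : sInf (E '' Ici T) ≤ E (a + L) := csInf_le hbdd hmem
  linarith

end Summit.FinalStateConjecture.FinalStateConjecture.Theorems
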